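import Mathlib
import Summits.AtomisticToContinuum.Crystallization.Theses.NashClassCertificates

/-!
# Sketch — crux idea `regular-equilibria-strict-lp` (crux stmt-AtomisticToContinuum-16826,
`NashClassCertificates.NashTwoShellGap`), ideator 2, round 1.

Only SIGNATURES are asked for at the idea stage; everything below elaborates (no `sorry` in
definitions; the two tiny lemmas at the end are proved).  The first checkable statement of the
line is `DeepStrainBadPricing` (pointwise Cauchy–Born pricing of a strain-bad particle deep inside a
coarsely-good EQUILIBRIUM region), stated over existing declarations only
(`IsTwoShellGood`, `siteEnergy`, `lennardJones`, `PeriodicConfiguration.energyPerParticle`).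
-/

noncomputable section

namespace Summit.AtomisticToContinuum.Crystallization.Cruxes.NashTwoShellGap.RegularEquilibria

open scoped BigOperators Classical
open Literature.MathematicalPhysics.StatisticalMechanics Literature.Geometry.DiscreteGeometry

/-- Euclidean `3`-space. -/
local notation "E3" => EuclideanSpace ℝ (Fin 3)

/-- The crux's inlined NASH (best-response) hypothesis: no particle lowers its site energy by
relocating to a free point. -/
def IsNash {N : ℕ} (x : Fin N → E3) : Prop :=
  ∀ (i : Fin N) (y : E3), (∀ j : Fin N, j ≠ i → y ≠ x j) →
    siteEnergy lennardJones x i ≤ ∑ j ∈ Finset.univ.erase i, lennardJones (dist y (x j))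

/-- `e* = ⨅` over periodic configurations of the energy per particle. -/
def eStar : ℝ := ⨅ Q : PeriodicConfiguration 3, Q.energyPerParticle lennardJones

/-- The crux, restated with the two abbreviations (definitionally the route decl, see
`crux_iff`). -/
def Crux : Prop :=
  ∃ g : ℝ, 0 < g ∧ ∀ (N : ℕ) (x : Fin N → E3),
    (∀ i j : Fin N, i ≠ j → 1 / 3 ≤ dist (x i) (x j)) → IsNash x →
      (N : ℝ) * eStar + g * (Nat.card {i : Fin N // ¬ IsTwoShellGood (1 / 20) (47 / 50) 1 x i} : ℝ)
        ≤ interactionEnergy lennardJones x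

theorem crux_iff :
    Crux ↔ Summit.AtomisticToContinuum.Crystallization.Theses.NashClassCertificates.NashTwoShellGap :=
  Iff.rfl

/-! ## First lemma of the line (signature) -/

/-- **FIRST LEMMA (P1, deep tier): pointwise Cauchy–Born pricing of strain-bad equilibria.**
There are a depth `R₀` and a price `κ > 0` such that in every `1/3`-separated NASH configuration, a
particle `i` all of whose neighbours within `R₀` (itself included) are COARSELY two-shell good
(tolerance `1/16`, scale window `[9/10, 49/50]` — chosen inside the phonon-stable tube: shear
`≤ 4.4 %`, no dilation beyond `+5.4 %` of `a*`, compression free) but which is itself `1/20`-BAD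
(the crux's predicate) has half site energy `≥ e* + κ`.
Mechanism: Nash ⇒ force balance; force balance + coarse goodness on `B(x_i, R₀)` + phonon stability
of the local Barlow word ⇒ (discrete interior regularity, Ehrlacher–Ortner–Shapeev / Thomée–
Westergren type) `|∇F| ≤ C·θ/R₀` at `i` ⇒ `e_i = W_s(F_i) ± C'θ/R₀` and
`W_s(F_i) − e* ≥ W_s(F_i) − W_s(F_s*) ≥ κ_CB·(1/20)²` (homogeneous Cauchy–Born cell, certified),
the reference being `i`'s OWN stacking word `s` at its own equilibrium — exact at every Barlow word,
so no hcp/fcc resolution is needed.  `κ ≈ κ_CB/800 ≈ 2·10⁻³`, `R₀ = O(10)` expected; both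
non-effective through the regularity constant. -/
def DeepStrainBadPricing : Prop :=
  ∃ R₀ κ : ℝ, 0 < κ ∧ ∀ (N : ℕ) (x : Fin N → E3),
    (∀ i j : Fin N, i ≠ j → 1 / 3 ≤ dist (x i) (x j)) → IsNash x →
    ∀ i : Fin N,
      (∀ j : Fin N, dist (x j) (x i) ≤ R₀ → IsTwoShellGood (1 / 16) (9 / 10) (49 / 50) x j) →
      ¬ IsTwoShellGood (1 / 20) (47 / 50) 1 x i →
        eStar + κ ≤ (1 / 2 : ℝ) * siteEnergy lennardJones x i

/-! ## The other two tiers, as signatures (P2 exposed is line `birth`'s `stub_exposedBadGap`;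
P3 = strict certificate on topologically defective saturated equilibrium stars). -/

/-- Hole-saturation (Aufbau) consequence of Nash used to shrink the P3 star family: no free point
of a Nash configuration is deeper than the worst-bound particle (plus the self term `1/12`). -/
def AufbauLevel {N : ℕ} (x : Fin N → E3) : Prop :=
  ∀ y : E3, (∀ j : Fin N, y ≠ x j) → ∀ i : Fin N,
    siteEnergy lennardJones x i ≤ (∑ j : Fin N, lennardJones (dist y (x j))) + 1 / 12

/-- On-site stability (Laplacian cut): the trace of the on-site Hessian is non-negative at every
particle of a Nash configuration — `Σ_j (11 r⁻¹⁴ − 5 r⁻⁸) ≥ 0`, so every particle has a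
neighbour within `(11/5)^{1/6} < 1.15`. -/
def LaplacianCut {N : ℕ} (x : Fin N → E3) : Prop :=
  ∀ i : Fin N, 0 ≤ ∑ j ∈ Finset.univ.erase i,
    (11 * ((dist (x i) (x j))⁻¹) ^ 14 - 5 * ((dist (x i) (x j))⁻¹) ^ 8)

/-- **P3 (the residual, strict form): strict transfer certificate on topologically defective
equilibrium stars.**  Typed here in its crudest summed form — what the architecture needs from the
LP tier: some `g₃ > 0` paying every `1/20`-bad particle that is NOT deep-coarsely-good (so: surface,
sub-surface, defect cores and their `R₀`-collars), GIVEN the deep tier.  (The real P3 statement is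
a finite-range transfer inequality over the compact family of `R₀`-stars of Nash configurations;
`g₃` then comes from strict positivity + compactness, not from an explicit margin.) -/
def CollarAndCorePricing (R₀ : ℝ) : Prop :=
  ∃ g₃ : ℝ, 0 < g₃ ∧ ∀ (N : ℕ) (x : Fin N → E3),
    (∀ i j : Fin N, i ≠ j → 1 / 3 ≤ dist (x i) (x j)) → IsNash x →
      (N : ℝ) * eStar
        + g₃ * (Nat.card {i : Fin N // ¬ IsTwoShellGood (1 / 20) (47 / 50) 1 x i ∧
            ¬ ∀ j : Fin N, dist (x j) (x i) ≤ R₀ → IsTwoShellGood (1 / 16) (9 / 10) (49 / 50) x j} : ℝ)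
        + ∑ i ∈ Finset.univ.filter (fun i : Fin N =>
            ¬ IsTwoShellGood (1 / 20) (47 / 50) 1 x i ∧
              ∀ j : Fin N, dist (x j) (x i) ≤ R₀ → IsTwoShellGood (1 / 16) (9 / 10) (49 / 50) x j),
            ((1 / 2 : ℝ) * siteEnergy lennardJones x i - eStar)
        ≤ interactionEnergy lennardJones x

/-! ## Two sanity lemmas (proved): Nash ⇒ Aufbau level; the route decl is `Crux`. -/

theorem aufbauLevel_of_isNash {N : ℕ} {x : Fin N → E3} (h : IsNash x) : AufbauLevel x := by
  intro y hy i
  have h1 := h i y fun j _ => hy j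
  have hsplit : ∑ j : Fin N, lennardJones (dist y (x j))
      = lennardJones (dist y (x i)) + ∑ j ∈ Finset.univ.erase i, lennardJones (dist y (x j)) := by
    rw [← Finset.add_sum_erase _ _ (Finset.mem_univ i)]
  have hV : -1 / 12 ≤ lennardJones (dist y (x i)) := neg_one_div_le_lennardJones _
  rw [hsplit]
  linarith

end Summit.AtomisticToContinuum.Crystallization.Cruxes.NashTwoShellGap.RegularEquilibria

end
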